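import Summits.AtomisticToContinuum.BoseEinsteinCondensation.Theorems.BECCutLineWeakDisorderLateCoreSplitDefs
import Summits.AtomisticToContinuum.BoseEinsteinCondensation.Theorems.BECCutLineWeakDisorderTwoReplicaTransienceBoundPerBoxAdmissible
import Summits.AtomisticToContinuum.BoseEinsteinCondensation.Theorems.BECCutLineWeakDisorderWitnessTransferHardSetMargin
import Summits.AtomisticToContinuum.BoseEinsteinCondensation.Theorems.TwoReplicaTransienceBound.Negative.ConstantAtLeastOne
import HarnessLib

/-!
# Route `BECCutLineWeakDisorder`, crux `TwoReplicaTransienceBound` (stmt-AtomisticToContinuum-9687), line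
# `late-core-split`: the split is LOSSLESS — `crux ⟺ Z ∧ A ∧ O`

Support file (`--supports stmt-AtomisticToContinuum-9687`, registered toolbox stub `stub_splitOfCrux`;
lead c7 adopting the crux strategist's line `Cruxes/TwoReplicaTransienceBound/Lines/late_core_split.lean`).
The vocabulary file `…LateCoreSplitDefs.lean` proves `Z → A → O → crux` (`TwoReplicaTransienceBound_of`)
and `crux → O`, `crux → Late`. This file proves the two remaining converses, so that the strategist's
decomposition of the crux along its two uniformities is an EQUIVALENCE, kernel-checked:

* `witnessZeroMode_of_crux : crux → Z` — Cauchy–Schwarz ACROSS slices: with `m(Y) = ∫Ψ_T(x,Y)²dx`,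
  `s(Y) = ∫Ψ_T(x,Y)dx`, `∫ m dY = 1` (the witness is `L²`-normalised as soon as `‖e^{-TH}1‖₂² ∉ {0,∞}`,
  which holds at low density for all large `n`: finite ground-state energy + the lower envelope),
  `1 = ∫ (√L³ m/s)(s/√L³) ≤ (∫ L³m²/s²)^{1/2} (∫ s²/L³)^{1/2}`, i.e. `L³ ≤ I(T)·S(T)`; so `I ≤ C`
  forces `S ≥ L³/C` (`c = 1/C`);
* `overlapNoIntermittency_of_crux : crux → A` — Cauchy–Schwarz WITHIN slices (`s² ≤ |Λ_L| m`,
  `Negative.slice_le_ratio`'s inequality) gives `S ≤ L³`, so `I·S ≤ C·L³` (`C₂ = C`);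
* `stub_splitOfCrux : crux ↔ Z ∧ A ∧ O`.

So every child of the split is negative-knowledge-safe (each can only fail where the crux fails), and
the reading of LeadC7Report §4 / STRATEGY-CENSUS §1(ii) is a theorem: the crux is EXACTLY
{late-time zero-mode ODLRO of the heat-flow witness} ∧ {no intermittency of the overlap} ∧ {no
transient overshoot in the polymer length}.
-/

noncomputable section

open MeasureTheory Filter Set
open scoped ENNReal NNReal Topology

namespace Summit.AtomisticToContinuum.BoseEinsteinCondensation.Cruxes.TwoReplicaTransienceBound.LateCoreSplit

open Literature.MathematicalPhysics.QuantumManyBody.BoseGas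
open Summit.AtomisticToContinuum.BoseEinsteinCondensation.Theses.BECCutLineWeakDisorder
open Summit.AtomisticToContinuum.BoseEinsteinCondensation.Theorems.CutLineWitness
open Summit.AtomisticToContinuum.BoseEinsteinCondensation.Theorems.TwoReplicaTransienceBound.Negative

variable {n : ℕ}

/-! ### Cauchy–Schwarz across slices: `|Λ_L| ≤ I · S` for a normalised bounded Dirichlet function -/

/-- **`L³ ≤ (∫ L³ m²/s² dY) · (∫ s² dY)`** for a measurable real `f` on `(ℝ³)^{n+1}`, bounded,
vanishing off `Λ_L^{n+1}` and with `∫ f² = 1` (`m(Y) = ∫ f(x,Y)² dx`, `s(Y) = ∫ |f(x,Y)| dx`):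
Cauchy–Schwarz in `Y` for `m = (√L³·m/s)·(s/√L³)` (slices with `s = 0` have `m = 0`; `s < ∞` by
the bound). [folklore] -/
theorem ofReal_volume_le_ratio_mul_sliceSq {L : ℝ} (hL : 0 < L) {f : Config (n + 1) → ℝ}
    (hf : Measurable f) (hsupp : ∀ X, X ∉ boxN (n + 1) L → f X = 0) {K : ℝ} (hK : ∀ X, |f X| ≤ K)
    (hnorm : ∫⁻ X, (‖f X‖₊ : ℝ≥0∞) ^ 2 = 1) :
    ENNReal.ofReal (L ^ 3) ≤
      (∫⁻ Y : Config n, ENNReal.ofReal (L ^ 3) *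
        (∫⁻ x, (‖f (Matrix.vecCons x Y)‖₊ : ℝ≥0∞) ^ 2) ^ 2 /
          (∫⁻ x, (‖f (Matrix.vecCons x Y)‖₊ : ℝ≥0∞)) ^ 2) *
      ∫⁻ Y : Config n, (∫⁻ x, (‖f (Matrix.vecCons x Y)‖₊ : ℝ≥0∞)) ^ 2 := by
  set m : Config n → ℝ≥0∞ := fun Y => ∫⁻ x, (‖f (Matrix.vecCons x Y)‖₊ : ℝ≥0∞) ^ 2 with hmdef
  set s : Config n → ℝ≥0∞ := fun Y => ∫⁻ x, (‖f (Matrix.vecCons x Y)‖₊ : ℝ≥0∞) with hsdef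
  have hmm : Measurable m := measurable_lintegral_nnnorm_pow_vecCons hf 2
  have hsm : Measurable s := measurable_lintegral_nnnorm_vecCons hf
  set V : ℝ≥0∞ := ENNReal.ofReal (L ^ 3) with hVdef
  have hV0 : V ≠ 0 := (ENNReal.ofReal_pos.2 (by positivity)).ne'
  have hVtop : V ≠ ⊤ := ENNReal.ofReal_ne_top
  set a : ℝ≥0∞ := ENNReal.ofReal (Real.sqrt (L ^ 3)) with hadef
  have ha0 : a ≠ 0 := (ENNReal.ofReal_pos.2 (Real.sqrt_pos.2 (by positivity))).ne'
  have hatop : a ≠ ⊤ := ENNReal.ofReal_ne_top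
  have ha2 : a ^ 2 = V := by
    rw [hadef, ← ENNReal.ofReal_pow (Real.sqrt_nonneg _), Real.sq_sqrt (by positivity)]
  -- slices: `s < ∞`, and `s = 0 ⇒ m = 0`
  have hstop : ∀ Y, s Y ≠ ⊤ := by
    intro Y
    by_cases hY : Y ∈ boxN n L
    · have hsx : ∀ x, x ∉ box L → f (Matrix.vecCons x Y) = 0 := fun x hx =>
        hsupp _ fun h => hx ((vecCons_mem_boxN_iff.1 h).1)
      exact ne_top_of_le_ne_top (ENNReal.mul_ne_top ENNReal.ofReal_ne_top (volume_box_ne_top L))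
        (lintegral_nnnorm_le_of_bound (fun x => hK _) hsx)
    · have h0 : ∀ x, f (Matrix.vecCons x Y) = 0 := fun x =>
        hsupp _ fun h => hY ((vecCons_mem_boxN_iff.1 h).2)
      simp [hsdef, h0]
  have hms : ∀ Y, s Y = 0 → m Y = 0 := by
    intro Y h0
    have hgm : Measurable fun x => (‖f (Matrix.vecCons x Y)‖₊ : ℝ≥0∞) :=
      (measurable_slice hf Y).nnnorm.coe_nnreal_ennreal
    have hae : (fun x => (‖f (Matrix.vecCons x Y)‖₊ : ℝ≥0∞)) =ᵐ[volume] 0 :=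
      (lintegral_eq_zero_iff hgm).1 h0
    show ∫⁻ x, (‖f (Matrix.vecCons x Y)‖₊ : ℝ≥0∞) ^ 2 = 0
    rw [lintegral_eq_zero_iff (hgm.pow_const 2)]
    filter_upwards [hae] with x hx
    simp [hx]
  -- the two Cauchy–Schwarz factors
  set F : Config n → ℝ≥0∞ := fun Y => a * m Y / s Y with hFdef
  set G : Config n → ℝ≥0∞ := fun Y => s Y / a with hGdef
  have hFm : Measurable F := (hmm.const_mul a).div hsm
  have hGm : Measurable G := hsm.div measurable_const
  have hmFG : ∀ Y, m Y ≤ F Y * G Y := by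
    intro Y
    rcases eq_or_ne (s Y) 0 with h0 | h0
    · rw [hms Y h0]; exact bot_le
    · refine le_of_eq ?_
      show m Y = a * m Y / s Y * (s Y / a)
      simp only [div_eq_mul_inv]
      calc m Y = m Y * (a * a⁻¹) * ((s Y)⁻¹ * s Y) := by
            rw [ENNReal.mul_inv_cancel ha0 hatop, ENNReal.inv_mul_cancel h0 (hstop Y), mul_one,
              mul_one]
        _ = a * m Y * (s Y)⁻¹ * (s Y * a⁻¹) := by ring
  have hF2 : ∀ Y, F Y ^ 2 = V * m Y ^ 2 / s Y ^ 2 := fun Y => by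
    show (a * m Y / s Y) ^ 2 = V * m Y ^ 2 / s Y ^ 2
    rw [div_eq_mul_inv, mul_pow, mul_pow, ← ENNReal.inv_pow, ha2, ← div_eq_mul_inv]
  have hG2 : ∀ Y, G Y ^ 2 = s Y ^ 2 * V⁻¹ := fun Y => by
    show (s Y / a) ^ 2 = s Y ^ 2 * V⁻¹
    rw [div_eq_mul_inv, mul_pow, ← ENNReal.inv_pow, ha2]
  -- `1 = ∫ m ≤ ∫ F G ≤ ‖F‖₂ ‖G‖₂`
  have hone : (1 : ℝ≥0∞) ≤ ∫⁻ Y, F Y * G Y :=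
    calc (1 : ℝ≥0∞) = ∫⁻ X, (‖f X‖₊ : ℝ≥0∞) ^ 2 := hnorm.symm
      _ = ∫⁻ Y : Config n, m Y :=
          lintegral_eq_lintegral_lintegral_vecCons (hf.nnnorm.coe_nnreal_ennreal.pow_const 2)
      _ ≤ ∫⁻ Y, F Y * G Y := lintegral_mono hmFG
  have hcs := ENNReal.lintegral_mul_le_Lp_mul_Lq volume Real.HolderConjugate.two_two
    hFm.aemeasurable hGm.aemeasurable
  have hsq : (1 : ℝ≥0∞) ≤ (∫⁻ Y, F Y ^ 2) * ∫⁻ Y, G Y ^ 2 :=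
    calc (1 : ℝ≥0∞) = 1 ^ 2 := (one_pow 2).symm
      _ ≤ ((∫⁻ Y, F Y ^ (2 : ℝ)) ^ (1 / (2 : ℝ)) * (∫⁻ Y, G Y ^ (2 : ℝ)) ^ (1 / (2 : ℝ))) ^ 2 := by
          gcongr; exact hone.trans (by simpa only [Pi.mul_apply] using hcs)
      _ = (∫⁻ Y, F Y ^ 2) * ∫⁻ Y, G Y ^ 2 := by
          rw [mul_pow, ← ENNReal.rpow_two, ← ENNReal.rpow_two, ← ENNReal.rpow_mul,
            ← ENNReal.rpow_mul]
          norm_num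
  -- identify the two factors
  have hIF : ∫⁻ Y, F Y ^ 2 = ∫⁻ Y, V * m Y ^ 2 / s Y ^ 2 := lintegral_congr fun Y => hF2 Y
  have hSG : ∫⁻ Y, G Y ^ 2 = (∫⁻ Y, s Y ^ 2) * V⁻¹ := by
    rw [← lintegral_mul_const _ (hsm.pow_const 2)]
    exact lintegral_congr fun Y => hG2 Y
  rw [hIF, hSG, ← mul_assoc] at hsq
  -- `1 ≤ I S V⁻¹ ⇒ V ≤ I S`
  calc V = 1 * V := (one_mul V).symm
    _ ≤ (∫⁻ Y, V * m Y ^ 2 / s Y ^ 2) * (∫⁻ Y, s Y ^ 2) * V⁻¹ * V := by gcongr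
    _ = (∫⁻ Y, V * m Y ^ 2 / s Y ^ 2) * ∫⁻ Y, s Y ^ 2 := by
        rw [mul_assoc, ENNReal.inv_mul_cancel hV0 hVtop, mul_one]

/-! ### Cauchy–Schwarz within slices: `S ≤ |Λ_L|` -/

/-- **`∫ s(Y)² dY ≤ L³`** for `f` as above: `s(Y)² ≤ |Λ_L| m(Y)` slice by slice and `∫ m = 1`.
[folklore] -/
theorem sliceSq_le_ofReal_volume {L : ℝ} (hL : 0 < L) {f : Config (n + 1) → ℝ}
    (hf : Measurable f) (hsupp : ∀ X, X ∉ boxN (n + 1) L → f X = 0)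
    (hnorm : ∫⁻ X, (‖f X‖₊ : ℝ≥0∞) ^ 2 = 1) :
    ∫⁻ Y : Config n, (∫⁻ x, (‖f (Matrix.vecCons x Y)‖₊ : ℝ≥0∞)) ^ 2 ≤ ENNReal.ofReal (L ^ 3) := by
  have hslice : ∀ Y : Config n, (∫⁻ x, (‖f (Matrix.vecCons x Y)‖₊ : ℝ≥0∞)) ^ 2 ≤
      ENNReal.ofReal (L ^ 3) * ∫⁻ x, (‖f (Matrix.vecCons x Y)‖₊ : ℝ≥0∞) ^ 2 := by
    intro Y
    set g : Space → ℝ := fun x => f (Matrix.vecCons x Y) with hgdef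
    have hgm : Measurable fun x => (‖g x‖₊ : ℝ≥0∞) :=
      (measurable_slice hf Y).nnnorm.coe_nnreal_ennreal
    have hsx : ∀ x, x ∉ box L → g x = 0 := by
      intro x hx
      by_cases hY : Y ∈ boxN n L
      · exact hsupp _ fun h => hx ((vecCons_mem_boxN_iff.1 h).1)
      · exact hsupp _ fun h => hY ((vecCons_mem_boxN_iff.1 h).2)
    have hind : ∀ x, (‖g x‖₊ : ℝ≥0∞) = (box L).indicator (fun _ => (1 : ℝ≥0∞)) x * ‖g x‖₊ := by
      intro x
      by_cases hx : x ∈ box L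
      · simp [Set.indicator_of_mem hx]
      · simp [Set.indicator_of_notMem hx, hsx x hx]
    have h1 := ENNReal.lintegral_mul_le_Lp_mul_Lq volume Real.HolderConjugate.two_two
      (f := (box L).indicator fun _ => (1 : ℝ≥0∞)) (g := fun x => (‖g x‖₊ : ℝ≥0∞))
      ((measurable_const.indicator (measurableSet_box L)).aemeasurable) hgm.aemeasurable
    have hI : ∫⁻ x, (box L).indicator (fun _ => (1 : ℝ≥0∞)) x ^ (2 : ℝ) = ENNReal.ofReal (L ^ 3) := by
      have : ∀ x, (box L).indicator (fun _ => (1 : ℝ≥0∞)) x ^ (2 : ℝ) =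
          (box L).indicator (fun _ => (1 : ℝ≥0∞)) x := fun x => by
        by_cases hx : x ∈ box L <;> simp [hx]
      simp_rw [this]
      rw [lintegral_indicator (measurableSet_box L), setLIntegral_const, one_mul, volume_box,
        ENNReal.ofReal_pow hL.le]
    calc (∫⁻ x, (‖g x‖₊ : ℝ≥0∞)) ^ 2
        = (∫⁻ x, (box L).indicator (fun _ => (1 : ℝ≥0∞)) x * ‖g x‖₊) ^ 2 := by
          congr 1; exact lintegral_congr fun x => hind x
      _ ≤ ((∫⁻ x, (box L).indicator (fun _ => (1 : ℝ≥0∞)) x ^ (2 : ℝ)) ^ (1 / (2 : ℝ)) *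
            (∫⁻ x, (‖g x‖₊ : ℝ≥0∞) ^ (2 : ℝ)) ^ (1 / (2 : ℝ))) ^ 2 := by
          gcongr; simpa only [Pi.mul_apply] using h1
      _ = ENNReal.ofReal (L ^ 3) * ∫⁻ x, (‖g x‖₊ : ℝ≥0∞) ^ 2 := by
          rw [hI, mul_pow, ← ENNReal.rpow_two, ← ENNReal.rpow_two, ← ENNReal.rpow_mul,
            ← ENNReal.rpow_mul]
          norm_num
  calc ∫⁻ Y : Config n, (∫⁻ x, (‖f (Matrix.vecCons x Y)‖₊ : ℝ≥0∞)) ^ 2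
      ≤ ∫⁻ Y : Config n, ENNReal.ofReal (L ^ 3) * ∫⁻ x, (‖f (Matrix.vecCons x Y)‖₊ : ℝ≥0∞) ^ 2 :=
        lintegral_mono hslice
    _ = ENNReal.ofReal (L ^ 3) * ∫⁻ Y : Config n, ∫⁻ x, (‖f (Matrix.vecCons x Y)‖₊ : ℝ≥0∞) ^ 2 := by
        rw [lintegral_const_mul _ (measurable_lintegral_nnnorm_pow_vecCons hf 2)]
    _ = ENNReal.ofReal (L ^ 3) * 1 := by
        rw [← lintegral_eq_lintegral_lintegral_vecCons (hf.nnnorm.coe_nnreal_ennreal.pow_const 2),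
          hnorm]
    _ = ENNReal.ofReal (L ^ 3) := mul_one _

/-! ### The witness at low density: normalised, bounded, Dirichlet -/

/-- At finite ground-state energy the flat-datum witness `Ψ_T` (`T ≥ 1`) is measurable, bounded,
vanishes off the box and has `∫ Ψ_T² = 1`. [folklore] -/
theorem fkWitness_one_data {v : ℝ → ℝ≥0∞} (hv : Measurable v) {L : ℝ} (hL : 0 < L)
    (hE : groundStateEnergy v (n + 1) L ≠ ⊤) {T : ℝ} (hT : 1 ≤ T) :
    ∃ K : ℝ, Measurable (fkWitness (N := n + 1) v L T (fun _ => (1 : ℝ≥0∞))) ∧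
      (∀ X, X ∉ boxN (n + 1) L → fkWitness (N := n + 1) v L T (fun _ => (1 : ℝ≥0∞)) X = 0) ∧
      (∀ X, |fkWitness (N := n + 1) v L T (fun _ => (1 : ℝ≥0∞)) X| ≤ K) ∧
      ∫⁻ X, (‖fkWitness (N := n + 1) v L T (fun _ => (1 : ℝ≥0∞)) X‖₊ : ℝ≥0∞) ^ 2 = 1 := by
  have hT0 : 0 ≤ T := zero_le_one.trans hT
  set 𝒩 := fkNormSq (N := n + 1) v L T (fun _ => (1 : ℝ≥0∞)) with h𝒩
  have h0 : 𝒩 ≠ 0 := PerBox.fkNormSq_one_ne_zero_of_energy_ne_top hv hL (Nat.le_add_left 1 n) hE hT0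
  have htop : 𝒩 ≠ ⊤ := fkNormSq_one_ne_top v L hT0
  refine ⟨(Real.sqrt 𝒩.toReal)⁻¹, measurable_fkWitness hv L T measurable_const,
    fun X hX => fkWitness_of_notMem v hT0 _ hX, fun X => ?_, ?_⟩
  · rw [abs_of_nonneg (fkWitness_nonneg v L T _ X), fkWitness_apply, div_eq_mul_inv]
    refine mul_le_of_le_one_left (inv_nonneg.2 (Real.sqrt_nonneg _)) ?_
    have := ENNReal.toReal_mono ENNReal.one_ne_top (fkPartition_le_one v L T X)
    simpa [fkPartition] using this
  · have h1 := lintegral_fkWitness_sq hv L T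
      (measurable_const : Measurable fun _ : Config (n + 1) => (1 : ℝ≥0∞)) h0 htop
    refine Eq.trans (lintegral_congr fun X => ?_) h1
    rw [← enorm_eq_nnnorm, Real.enorm_of_nonneg (fkWitness_nonneg v L T _ X)]

/-! ### The converses: `crux → Z`, `crux → A`; hence `crux ↔ Z ∧ A ∧ O` -/

/-- **`crux → Z`**: the two-replica bound forces late-time zero-mode ODLRO of the witness, with
`c = 1/C` (`L³ ≤ I·S` and `I ≤ C`). -/
theorem witnessZeroMode_of_crux (h : TwoReplicaTransienceBound) : WitnessZeroMode := by
  intro v hv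
  obtain ⟨ρ₁, hρ₁, H1⟩ := h v hv
  obtain ⟨ρ₂, hρ₂, H2⟩ := glue_eventually_groundStateEnergy_ne_top v hv
  refine ⟨min ρ₁ ρ₂, lt_min hρ₁ hρ₂, fun ρ hρ hρlt => ?_⟩
  obtain ⟨C, hC, hevC⟩ := H1 ρ hρ (hρlt.trans_le (min_le_left _ _))
  refine ⟨1 / C, by positivity, ?_⟩
  filter_upwards [hevC, H2 ρ hρ (hρlt.trans_le (min_le_right _ _))] with n hn hEfin
  filter_upwards [eventually_ge_atTop (1 : ℝ)] with T hT
  have hL : 0 < sideLength ρ (n + 1) :=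
    Real.rpow_pos_of_pos (div_pos (Nat.cast_pos.mpr n.succ_pos) hρ) _
  obtain ⟨K, hfm, hsupp, hK, hnorm⟩ := fkWitness_one_data (n := n) hv.1 hL hEfin hT
  have hVIS := ofReal_volume_le_ratio_mul_sliceSq hL hfm hsupp hK hnorm
  have hI := hn T hT
  set V : ℝ≥0∞ := ENNReal.ofReal (sideLength ρ (n + 1) ^ 3) with hVdef
  have hle : V ≤ ENNReal.ofReal C * sliceMassSq v ρ n T :=
    hVIS.trans (mul_le_mul' hI le_rfl)
  have hC0 : ENNReal.ofReal C ≠ 0 := (ENNReal.ofReal_pos.2 hC).ne'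
  calc ENNReal.ofReal (1 / C * sideLength ρ (n + 1) ^ 3)
      = V / ENNReal.ofReal C := by
        rw [hVdef, one_div, inv_mul_eq_div, ENNReal.ofReal_div_of_pos hC]
    _ ≤ sliceMassSq v ρ n T := by
        rw [ENNReal.div_le_iff_le_mul (Or.inl hC0) (Or.inl ENNReal.ofReal_ne_top), mul_comm]
        exact hle

/-- **`crux → A`**: the two-replica bound and `S ≤ L³` give no-intermittency with `C₂ = C`. -/
theorem overlapNoIntermittency_of_crux (h : TwoReplicaTransienceBound) : OverlapNoIntermittency := by
  intro v hv
  obtain ⟨ρ₁, hρ₁, H1⟩ := h v hv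
  obtain ⟨ρ₂, hρ₂, H2⟩ := glue_eventually_groundStateEnergy_ne_top v hv
  refine ⟨min ρ₁ ρ₂, lt_min hρ₁ hρ₂, fun ρ hρ hρlt => ?_⟩
  obtain ⟨C, hC, hevC⟩ := H1 ρ hρ (hρlt.trans_le (min_le_left _ _))
  refine ⟨C, hC, ?_⟩
  filter_upwards [hevC, H2 ρ hρ (hρlt.trans_le (min_le_right _ _))] with n hn hEfin
  filter_upwards [eventually_ge_atTop (1 : ℝ)] with T hT
  have hL : 0 < sideLength ρ (n + 1) :=
    Real.rpow_pos_of_pos (div_pos (Nat.cast_pos.mpr n.succ_pos) hρ) _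
  obtain ⟨K, hfm, hsupp, -, hnorm⟩ := fkWitness_one_data (n := n) hv.1 hL hEfin hT
  exact mul_le_mul' (hn T hT) (sliceSq_le_ofReal_volume hL hfm hsupp hnorm)

/-- **Registered toolbox stub `stub_splitOfCrux`: the split of the crux along its two uniformities
is an equivalence** — `TwoReplicaTransienceBound ↔ Z ∧ A ∧ O`. -/
theorem stub_splitOfCrux : TwoReplicaTransienceBound ↔ WitnessZeroMode ∧ OverlapNoIntermittency ∧ NoTransientOvershoot :=
  ⟨fun h => ⟨witnessZeroMode_of_crux h, overlapNoIntermittency_of_crux h,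
    noTransientOvershoot_of_crux h⟩, fun h => TwoReplicaTransienceBound_of h.1 h.2.1 h.2.2⟩

end Summit.AtomisticToContinuum.BoseEinsteinCondensation.Cruxes.TwoReplicaTransienceBound.LateCoreSplit

end
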